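import Summits.BirchSwinnertonDyer.BirchSwinnertonDyer.Theorems.Rank1ResidualJetCompatibleData
import Literature.NumberTheory.EllipticCurves.HeegnerPointsOfConductorRationalityProofs
import Literature.NumberTheory.EllipticCurves.RingClassGalOverCyclicProofs
import HarnessLib

/-!
# T1 JET (cell `bsd-jet`), road K — striking McCallum 1991 Prop. 5.2 (`h52`), brick 8: the plumbing
# binder `hcompat` — COMPATIBLE DATA TRIPLE (one datum at `n·ℓ'` compatible DOWN to a given datum at
# `n` AND to some datum at `n·ℓ'/ℓ₀`), from x11b's coherent ring class tower

HONEST FRAMING (programme file §HONESTY, verbatim): «no tranche here proves BSD; ARM L moves the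
LITERAL column of an r ≤ 1 census into the kernel-proved-modulo-named-print column.» THEOREMS ONLY
(seat `bsd-jet-pv-2`, session g6; `--supports stmt-BirchSwinnertonDyer-14418`, helper); 0 classes move;
road-K DOCUMENTARY. Nothing is asserted about any curve; no item closes.

WHAT. Kolyvagin's prime swap `n ↦ n·ℓ'/ℓ₀` (bricks 2a/2b) reads McCallum's Prop. 4.4 at TWO places:
`λ' ∣ ℓ'` for the pair `(n, n·ℓ')` and `λ₀ ∣ ℓ₀` for `(n·ℓ'/ℓ₀, n·ℓ')`, so it needs ONE datum `d'` at
`n·ℓ'` compatible (McCallum's four clauses: generators `σ`, transversal `S` both ways, embedding) with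
the GIVEN datum `d` at `n` and with SOME datum `d''` at `n·ℓ'/ℓ₀` — the binder `hcompat` of brick 4
`Swap.exists_conductor_levelIndex_ge_of_minDepth`. The tree had the upward half
(`JET.exists_compatible_datum_mul`, pv-2 g2). `exists_compatible_data_triple` builds both from x11b's
coherent tower at the top conductor (`RingClassTower.exists_coherent_towerData`): `d'` exactly as in the
upward construction (generators `g_q^{a_q}` matching `d.σ`, lifts of `d.S`, `IsAlgClosed.lift` of
`d.emb`), and `d''` by RESTRICTION of `d'` along `K[n·ℓ'/ℓ₀] ⊆ K[n·ℓ']` (`σ'' = res σ'`,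
`S'' = res S'` — the restriction of a transversal of `G_N` in `𝒢_N` is a transversal of `G_m` in `𝒢_m`,
both being `≅ Gal(K[1]/K)` — and `emb'' = emb' ∘ incl`); `exists_compatible_data_triple_of_grossCM`
supplies the CM points by the two PROVED Gross §3 facts (`nonempty_kolyvaginHeegnerData_of_grossCM`).
References (locators only): [cite: GrossLMS1991, §3 (pp. 238–239), §4 (4.1)] [cite: McCallumLMS1991,
§4 (p. 300), Prop. 4.4 (p. 301), §5 proof of Prop. 5.2 (p. 306)]. Design: no definitions; `K : Type`.
Axioms: `propext`, `Classical.choice`, `Quot.sound`.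
-/

set_option autoImplicit false

noncomputable section

open scoped Classical

open WeierstrassCurve Field NumberField IsDedekindDomain
  Literature.NumberTheory.EllipticCurves Literature.NumberTheory.EllipticCurves.ModularForms
  Literature.NumberTheory.EllipticCurves.RingClassField
  Summit.BirchSwinnertonDyer.Rank1Residual.X11b
  Summit.BirchSwinnertonDyer.BirchSwinnertonDyer.Theorems

namespace Summit.BirchSwinnertonDyer.Rank1Residual.JET

variable {K : Type} [Field K] [NumberField K] {N : ℕ} [NeZero N] {W : WeierstrassCurve ℚ}

set_option maxHeartbeats 800000 in
/-- **Compatible data TRIPLE from the coherent tower.** For `K` imaginary quadratic with `d_K < −4`, a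
frame `(Dt, β, ι)`, a square-free `c·ℓ` with inert prime factors (`ℓ` prime, `ℓ ∤ c`), a prime `q₀ ∣ c`,
a datum `d` of conductor `c`, and CM points `y'` at `c·ℓ` and `y''` at `c/q₀·ℓ`: there are data `d'` of
conductor `c·ℓ` and `d''` of conductor `c/q₀·ℓ` such that `d'` restricts to `d` along `K[c] ⊆ K[cℓ]`
and to `d''` along `K[cℓ/q₀] ⊆ K[cℓ]` in McCallum's four clauses (`σ`, `S` both ways, `emb`).
[cite: GrossLMS1991, §3 (pp. 238–239), §4 (4.1)] [cite: McCallumLMS1991, §4 (p. 300), Prop. 4.4 (p. 301)] -/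
theorem exists_compatible_data_triple (hK : IsImaginaryQuadratic K) (hD : NumberField.discr K < -4)
    (ι : K →+* ℂ) (Dt : ModularParametrizationData W N) {β : ℤ}
    {c ℓ q₀ : ℕ} (hcl : Squarefree (c * ℓ)) (hq₀ : q₀ ∈ c.primeFactors)
    (hinert : ∀ q ∈ (c * ℓ).primeFactors, (Ideal.span {(q : 𝓞 K)}).IsPrime)
    (d : KolyvaginHeegnerData Dt β ι c)
    (y' : (W.baseChange (ringClassField K ι (c * ℓ))).toAffine.Point)
    (hy' : WeierstrassCurve.Affine.Point.map (ringClassField K ι (c * ℓ)).subtype.toRatAlgHom y' =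
      heegnerPointComplexOfConductor Dt (NumberField.discr K) β (c * ℓ))
    (y'' : (W.baseChange (ringClassField K ι (c / q₀ * ℓ))).toAffine.Point)
    (hy'' : WeierstrassCurve.Affine.Point.map (ringClassField K ι (c / q₀ * ℓ)).subtype.toRatAlgHom y'' =
      heegnerPointComplexOfConductor Dt (NumberField.discr K) β (c / q₀ * ℓ)) :
    ∃ (d' : KolyvaginHeegnerData Dt β ι (c * ℓ)) (d'' : KolyvaginHeegnerData Dt β ι (c / q₀ * ℓ)),
      (∀ l' ∈ c.primeFactors, ∀ (x : ringClassField K ι c) (x' : ringClassField K ι (c * ℓ)),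
        (x : ℂ) = x' → ((d'.σ l' x' : ringClassField K ι (c * ℓ)) : ℂ) = (d.σ l' x : ℂ)) ∧
      (∀ s ∈ d.S, ∃ s' ∈ d'.S, ∀ (x : ringClassField K ι c) (x' : ringClassField K ι (c * ℓ)),
        (x : ℂ) = x' → ((s' x' : ringClassField K ι (c * ℓ)) : ℂ) = (s x : ℂ)) ∧
      (∀ s' ∈ d'.S, ∃ s ∈ d.S, ∀ (x : ringClassField K ι c) (x' : ringClassField K ι (c * ℓ)),
        (x : ℂ) = x' → ((s' x' : ringClassField K ι (c * ℓ)) : ℂ) = (s x : ℂ)) ∧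
      (∀ (x : ringClassField K ι c) (x' : ringClassField K ι (c * ℓ)),
        (x : ℂ) = x' → d'.emb x' = d.emb x) ∧
      (∀ l' ∈ (c / q₀ * ℓ).primeFactors, ∀ (x : ringClassField K ι (c / q₀ * ℓ))
        (x' : ringClassField K ι (c * ℓ)),
        (x : ℂ) = x' → ((d'.σ l' x' : ringClassField K ι (c * ℓ)) : ℂ) = (d''.σ l' x : ℂ)) ∧
      (∀ s ∈ d''.S, ∃ s' ∈ d'.S, ∀ (x : ringClassField K ι (c / q₀ * ℓ))
        (x' : ringClassField K ι (c * ℓ)),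
        (x : ℂ) = x' → ((s' x' : ringClassField K ι (c * ℓ)) : ℂ) = (s x : ℂ)) ∧
      (∀ s' ∈ d'.S, ∃ s ∈ d''.S, ∀ (x : ringClassField K ι (c / q₀ * ℓ))
        (x' : ringClassField K ι (c * ℓ)),
        (x : ℂ) = x' → ((s' x' : ringClassField K ι (c * ℓ)) : ℂ) = (s x : ℂ)) ∧
      (∀ (x : ringClassField K ι (c / q₀ * ℓ)) (x' : ringClassField K ι (c * ℓ)),
        (x : ℂ) = x' → d'.emb x' = d''.emb x) := by
  -- elementary facts (`n = cℓ`, `m'' = c/q₀ · ℓ`)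
  have hn0 : c * ℓ ≠ 0 := hcl.ne_zero
  have hc0 : c ≠ 0 := fun h ↦ hn0 (by rw [h, zero_mul])
  have hcn : c ∣ c * ℓ := Dvd.intro ℓ rfl
  have hcsq : Squarefree c := hcl.squarefree_of_dvd hcn
  have hq₀c : q₀ ∣ c := Nat.dvd_of_mem_primeFactors hq₀
  have hmn : c / q₀ * ℓ ∣ c * ℓ := Nat.mul_dvd_mul_right (Nat.div_dvd_of_dvd hq₀c) ℓ
  have hm0 : c / q₀ * ℓ ≠ 0 := fun h ↦ hn0 (Nat.eq_zero_of_zero_dvd (h ▸ hmn))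
  have hmsq : Squarefree (c / q₀ * ℓ) := hcl.squarefree_of_dvd hmn
  have hle : ringClassField K ι c ≤ ringClassField K ι (c * ℓ) := ringClassField_mono hK ι hcn hn0
  have hle'' : ringClassField K ι (c / q₀ * ℓ) ≤ ringClassField K ι (c * ℓ) :=
    ringClassField_mono hK ι hmn hn0
  have h1le : ringClassField K ι 1 ≤ ringClassField K ι c := ringClassField_mono hK ι (one_dvd c) hc0
  have h1le'' : ringClassField K ι 1 ≤ ringClassField K ι (c / q₀ * ℓ) :=
    ringClassField_mono hK ι (one_dvd _) hm0
  -- x11b3's coherent tower at the top level `n = cℓ`: restriction homs and generators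
  obtain ⟨res, g, -, h1, h2, h3, h4, -⟩ := RingClassTower.exists_coherent_towerData hK ι hcl hinert
  have hr := h1 c hcn
  have hr'' := h1 (c / q₀ * ℓ) hmn
  -- (σ) for `q ∣ c`: `d.σ q = res (g q) ^ a q` with `a q` invertible mod `q + 1`
  have hpow : ∀ q ∈ c.primeFactors, ∃ a b : ℕ, d.σ q = (res c (g q)) ^ a ∧ a * b % (q + 1) = 1 := by
    intro q hq
    have hqp : q.Prime := Nat.prime_of_mem_primeFactors hq
    have hqc : q ∣ c := Nat.dvd_of_mem_primeFactors hq
    have hqn : q ∈ (c * ℓ).primeFactors := Nat.primeFactors_mono hcn hn0 hq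
    have hndvd : ¬ q ∣ c / q := fun h ↦ by
      have : q * q ∣ c := by
        have := Nat.mul_dvd_mul_left q h
        rwa [Nat.mul_div_cancel' hqc] at this
      exact hqp.one_lt.ne' (Nat.isUnit_iff.mp (hcsq q this))
    have hord : orderOf (res c (g q)) = q + 1 :=
      RingClassTower.orderOf_eq_succ_of_zpowers_eq_ringClassGalOver hK ι hqp (hinert q hqn) hqc hndvd
        hc0 (Or.inr hD) (h4 c hcn q hq).1
    exact KolyvaginChoice.exists_pow_eq_of_zpowers_eq hqp.ne_zero hord
      ((d.zpowers_σ q hq).trans (h4 c hcn q hq).1.symm)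
  choose! a b ha hab using hpow
  -- the generators at level `cℓ`, as elements of `𝒢_n`
  let σG : ℕ → ringClassGal ι (c * ℓ) := fun q ↦ if q ∈ c.primeFactors then g q ^ a q else g q
  let σ' : ℕ → (ringClassField K ι (c * ℓ) ≃ₐ[ℚ] ringClassField K ι (c * ℓ)) := fun q ↦ (σG q : _)
  have hσ'c : ∀ q ∈ c.primeFactors, σ' q = (g q : ringClassField K ι (c * ℓ) ≃ₐ[ℚ] _) ^ a q := by
    intro q hq
    simp only [σ', σG, hq, if_true, SubgroupClass.coe_pow]
  have hσ'nc : ∀ q, q ∉ c.primeFactors → σ' q = (g q : ringClassField K ι (c * ℓ) ≃ₐ[ℚ] _) := by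
    intro q hq
    simp only [σ', σG, hq, if_false]
  have hgtop : ∀ q ∈ (c * ℓ).primeFactors,
      Subgroup.zpowers (g q : ringClassField K ι (c * ℓ) ≃ₐ[ℚ] ringClassField K ι (c * ℓ)) =
        ringClassGalOver ι (c * ℓ) (c * ℓ / q) ∧
      (g q : ringClassField K ι (c * ℓ) ≃ₐ[ℚ] ringClassField K ι (c * ℓ)) ^ (q + 1) = 1 := by
    intro q hq
    have h := h4 (c * ℓ) dvd_rfl q hq
    rw [h2 (g q)] at h
    exact h
  have hσ'z : ∀ q ∈ (c * ℓ).primeFactors, Subgroup.zpowers (σ' q) = ringClassGalOver ι (c * ℓ) (c * ℓ / q) := by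
    intro q hq
    by_cases hqc : q ∈ c.primeFactors
    · rw [hσ'c q hqc, zpowers_pow_eq_of_mul_mod_eq_one (hgtop q hq).2 (hab q hqc)]
      exact (hgtop q hq).1
    · rw [hσ'nc q hqc]
      exact (hgtop q hq).1
  -- the generators at level `m'' = c/q₀ · ℓ`: restrictions
  let σ'' : ℕ → (ringClassField K ι (c / q₀ * ℓ) ≃ₐ[ℚ] ringClassField K ι (c / q₀ * ℓ)) :=
    fun q ↦ res (c / q₀ * ℓ) (σG q)
  have hσ''z : ∀ q ∈ (c / q₀ * ℓ).primeFactors,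
      Subgroup.zpowers (σ'' q) = ringClassGalOver ι (c / q₀ * ℓ) (c / q₀ * ℓ / q) := by
    intro q hq
    have h := h4 (c / q₀ * ℓ) hmn q hq
    by_cases hqc : q ∈ c.primeFactors
    · have : σ'' q = (res (c / q₀ * ℓ) (g q)) ^ a q := by
        simp only [σ'', σG, hqc, if_true, map_pow]
      rw [this, zpowers_pow_eq_of_mul_mod_eq_one h.2 (hab q hqc)]
      exact h.1
    · have : σ'' q = res (c / q₀ * ℓ) (g q) := by
        simp only [σ'', σG, hqc, if_false]
      rw [this]
      exact h.1
  -- (S) lifts of `d.S` along `res c`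
  have hliftex : ∀ s : ringClassField K ι c ≃ₐ[ℚ] ringClassField K ι c, ∃ t : ringClassGal ι (c * ℓ),
      s ∈ ringClassGal ι c → res c t = s := by
    intro s
    by_cases hs : s ∈ ringClassGal ι c
    · obtain ⟨t, ht⟩ := RingClassTower.exists_restrictHom_eq hK ι hcn hn0 hr hs
      exact ⟨t, fun _ ↦ ht⟩
    · exact ⟨1, fun h ↦ (hs h).elim⟩
  choose lift hlift using hliftex
  let S' : Finset (ringClassField K ι (c * ℓ) ≃ₐ[ℚ] ringClassField K ι (c * ℓ)) :=
    d.S.image fun s ↦ (lift s : ringClassField K ι (c * ℓ) ≃ₐ[ℚ] ringClassField K ι (c * ℓ))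
  let S'' : Finset (ringClassField K ι (c / q₀ * ℓ) ≃ₐ[ℚ] ringClassField K ι (c / q₀ * ℓ)) :=
    d.S.image fun s ↦ res (c / q₀ * ℓ) (lift s)
  -- (emb) extend `d.emb` along `K[c] ⊆ K[n]`, then restrict along `K[m''] ⊆ K[n]`
  letI algCn : Algebra (ringClassField K ι c) (ringClassField K ι (c * ℓ)) :=
    (RingClassField.inclusion ι hle).toRingHom.toAlgebra
  haveI : IsScalarTower K (ringClassField K ι c) (ringClassField K ι (c * ℓ)) :=
    IsScalarTower.of_algebraMap_eq fun k ↦ ((RingClassField.inclusion ι hle).commutes k).symm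
  letI algCA : Algebra (ringClassField K ι c) (AlgebraicClosure K) := d.emb.toAlgebra
  haveI := (finiteDimensional_and_isGalois_ringClassField hK ι hn0).1
  haveI : Algebra.IsAlgebraic K (ringClassField K ι (c * ℓ)) := Algebra.IsAlgebraic.of_finite K _
  haveI : Algebra.IsAlgebraic (ringClassField K ι c) (ringClassField K ι (c * ℓ)) :=
    Algebra.IsAlgebraic.tower_top (K := K) (ringClassField K ι c)
  let e : ringClassField K ι (c * ℓ) →ₐ[ringClassField K ι c] AlgebraicClosure K := IsAlgClosed.lift
  have he : ∀ x : ringClassField K ι c, e (RingClassField.inclusion ι hle x) = d.emb x := fun x ↦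
    e.commutes x
  have hincl : ∀ (x : ringClassField K ι c) (x' : ringClassField K ι (c * ℓ)), (x : ℂ) = x' →
      x' = RingClassField.inclusion ι hle x := fun x x' hxx' ↦
    Subtype.ext (by rw [RingClassField.coe_inclusion]; exact hxx'.symm)
  have hincl'' : ∀ (x : ringClassField K ι (c / q₀ * ℓ)) (x' : ringClassField K ι (c * ℓ)), (x : ℂ) = x' →
      x' = RingClassField.inclusion ι hle'' x := fun x x' hxx' ↦
    Subtype.ext (by rw [RingClassField.coe_inclusion]; exact hxx'.symm)
  have hembK : ∀ k : K, e (algebraMap K (ringClassField K ι (c * ℓ)) k) = algebraMap K (AlgebraicClosure K) k := by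
    intro k
    rw [IsScalarTower.algebraMap_apply K (ringClassField K ι c) (ringClassField K ι (c * ℓ)) k]
    change e (RingClassField.inclusion ι hle (algebraMap K (ringClassField K ι c) k)) = _
    rw [he, d.emb_apply]
  -- the transversal property of the lifted system at ANY level `m ∣ n` reached by restriction
  have htransv : ∀ (m : ℕ) (hm : m ∣ c * ℓ), ringClassField K ι 1 ≤ ringClassField K ι m →
      ∀ G ∈ ringClassGal ι m, ∃! s, s ∈ d.S.image (fun s₀ ↦ res m (lift s₀)) ∧
        G⁻¹ * s ∈ ringClassGalOver ι m 1 := by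
    intro m hm h1m G hG
    have hrm := h1 m hm
    obtain ⟨Gg, hGg⟩ := RingClassTower.exists_restrictHom_eq hK ι hm hn0 hrm hG
    have hh : res c Gg ∈ ringClassGal ι c := h3 c hcn Gg
    obtain ⟨s, ⟨hsS, hs1⟩, huniq⟩ := d.S_transversal (res c Gg) hh
    have hsG : s ∈ ringClassGal ι c := d.S_subset s hsS
    have hres_s : res c (lift s) = s := hlift s hsG
    refine ⟨res m (lift s), ⟨?_, ?_⟩, ?_⟩
    · exact Finset.mem_image.mpr ⟨s, hsS, rfl⟩
    · have hmem : res c (Gg⁻¹ * lift s) ∈ ringClassGalOver ι c 1 := by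
        rw [map_mul, map_inv, hres_s]
        exact hs1
      have htop := RingClassTower.mem_ringClassGalOver_of_restrictHom_mem ι hr h1le (Gg⁻¹ * lift s) hmem
      have hm' := RingClassTower.restrictHom_mem_ringClassGalOver hK ι hm hn0 hrm (Gg⁻¹ * lift s) htop
      rwa [map_mul, map_inv, hGg] at hm'
    · rintro s'' ⟨hs''S, hs''1⟩
      obtain ⟨s₂, hs₂S, rfl⟩ := Finset.mem_image.mp hs''S
      have hs₂G : s₂ ∈ ringClassGal ι c := d.S_subset s₂ hs₂S
      have hmem : res m (Gg⁻¹ * lift s₂) ∈ ringClassGalOver ι m 1 := by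
        rw [map_mul, map_inv, hGg]; exact hs''1
      have htop := RingClassTower.mem_ringClassGalOver_of_restrictHom_mem ι hrm h1m (Gg⁻¹ * lift s₂) hmem
      have hc' := RingClassTower.restrictHom_mem_ringClassGalOver hK ι hcn hn0 hr (Gg⁻¹ * lift s₂) htop
      rw [map_mul, map_inv, hlift s₂ hs₂G] at hc'
      rw [huniq s₂ ⟨hs₂S, hc'⟩]
  -- the datum at `cℓ`
  let d' : KolyvaginHeegnerData Dt β ι (c * ℓ) :=
    { dvd_sq_sub := d.dvd_sq_sub
      y := y'
      map_y := hy'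
      σ := σ'
      zpowers_σ := hσ'z
      S := S'
      S_subset := by
        intro s hs
        obtain ⟨s₀, -, rfl⟩ := Finset.mem_image.mp hs
        exact (lift s₀).2
      S_transversal := by
        intro G hG
        have h := htransv (c * ℓ) dvd_rfl (h1le.trans hle) G hG
        have hSS : d.S.image (fun s₀ ↦ res (c * ℓ) (lift s₀)) = S' :=
          Finset.image_congr fun s₀ _ ↦ h2 (lift s₀)
        rwa [hSS] at h
      emb := e.toRingHom
      emb_apply := hembK }
  -- the datum at `c/q₀ · ℓ`
  let d'' : KolyvaginHeegnerData Dt β ι (c / q₀ * ℓ) :=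
    { dvd_sq_sub := d.dvd_sq_sub
      y := y''
      map_y := hy''
      σ := σ''
      zpowers_σ := hσ''z
      S := S''
      S_subset := by
        intro s hs
        obtain ⟨s₀, -, rfl⟩ := Finset.mem_image.mp hs
        exact h3 _ hmn (lift s₀)
      S_transversal := htransv (c / q₀ * ℓ) hmn h1le''
      emb := e.toRingHom.comp (RingClassField.inclusion ι hle'').toRingHom
      emb_apply := by
        intro k
        change e (RingClassField.inclusion ι hle'' (algebraMap K (ringClassField K ι (c / q₀ * ℓ)) k)) = _
        have : RingClassField.inclusion ι hle'' (algebraMap K (ringClassField K ι (c / q₀ * ℓ)) k) =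
            algebraMap K (ringClassField K ι (c * ℓ)) k := (RingClassField.inclusion ι hle'').commutes k
        rw [this, hembK] }
  refine ⟨d', d'', ?_, ?_, ?_, ?_, ?_, ?_, ?_, ?_⟩
  · -- `hσ` (c ≼ cℓ)
    intro l' hl' x x' hxx'
    change ((σ' l' x' : ringClassField K ι (c * ℓ)) : ℂ) = _
    rw [hσ'c l' hl', ha l' hl', ← SubgroupClass.coe_pow, ← hr ((g l') ^ a l') x x' hxx', map_pow]
  · -- `hS`
    intro s hs
    refine ⟨(lift s : ringClassField K ι (c * ℓ) ≃ₐ[ℚ] ringClassField K ι (c * ℓ)),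
      Finset.mem_image.mpr ⟨s, hs, rfl⟩, fun x x' hxx' ↦ ?_⟩
    rw [← hr (lift s) x x' hxx', hlift s (d.S_subset s hs)]
  · -- `hS'`
    intro s' hs'
    obtain ⟨s, hs, rfl⟩ := Finset.mem_image.mp hs'
    refine ⟨s, hs, fun x x' hxx' ↦ ?_⟩
    rw [← hr (lift s) x x' hxx', hlift s (d.S_subset s hs)]
  · -- `hemb`
    intro x x' hxx'
    change e x' = d.emb x
    rw [hincl x x' hxx']
    exact he x
  · -- `hσ₁` (c/q₀·ℓ ≼ cℓ)
    intro l' hl' x x' hxx'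
    change (((σG l' : ringClassField K ι (c * ℓ) ≃ₐ[ℚ] ringClassField K ι (c * ℓ)) x' :
      ringClassField K ι (c * ℓ)) : ℂ) = ((res (c / q₀ * ℓ) (σG l') x : ringClassField K ι (c / q₀ * ℓ)) : ℂ)
    exact (hr'' (σG l') x x' hxx').symm
  · -- `hS₁`
    intro s hs
    obtain ⟨s₀, hs₀, rfl⟩ := Finset.mem_image.mp hs
    refine ⟨(lift s₀ : ringClassField K ι (c * ℓ) ≃ₐ[ℚ] ringClassField K ι (c * ℓ)),
      Finset.mem_image.mpr ⟨s₀, hs₀, rfl⟩, fun x x' hxx' ↦ (hr'' (lift s₀) x x' hxx').symm⟩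
  · -- `hS₁'`
    intro s' hs'
    obtain ⟨s₀, hs₀, rfl⟩ := Finset.mem_image.mp hs'
    exact ⟨res (c / q₀ * ℓ) (lift s₀), Finset.mem_image.mpr ⟨s₀, hs₀, rfl⟩,
      fun x x' hxx' ↦ (hr'' (lift s₀) x x' hxx').symm⟩
  · -- `hemb₁`
    intro x x' hxx'
    change e x' = e (RingClassField.inclusion ι hle'' x)
    rw [hincl'' x x' hxx']

/-- **The binder `hcompat` of brick 4 DISCHARGED** (modulo nothing: the CM points come from the two
PROVED Gross §3 facts via `nonempty_kolyvaginHeegnerData_of_grossCM`): for `E/ℚ` elliptic, `K`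
imaginary quadratic with `d_K < −4` and the Heegner hypothesis, a frame, a square-free conductor `n` of
Kolyvagin primes, a prime `ℓ₀ ∣ n`, a Kolyvagin prime `ℓ' ∤ n` and ANY datum `d` at `n`: data `d'` at
`n·ℓ'` and `d''` at `n/ℓ₀·ℓ'` with `d ≼ d'` and `d'' ≼ d'`. [cite: GrossLMS1991, §3 (pp. 238–239), §4 (4.1)]
[cite: McCallumLMS1991, §4 (p. 300), §5 proof of Prop. 5.2 (p. 306)] -/
theorem exists_compatible_data_triple_of_grossCM [W.IsElliptic] [W.IsGloballyMinimal]
    (hK : IsImaginaryQuadratic K) (hD : NumberField.discr K < -4) (hH : SatisfiesHeegnerHypothesis N K)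
    (p : ℕ) (Dt : ModularParametrizationData W N) (β : ℤ) (ι : K →+* ℂ)
    {n l₀ ℓ' : ℕ} (hn : Squarefree n) (hnK : ∀ q ∈ n.primeFactors, Zhang2014.IsKolyvaginPrime N W K p q)
    (hl₀ : l₀ ∈ n.primeFactors) (hKol' : Zhang2014.IsKolyvaginPrime N W K p ℓ') (hℓ'n : ℓ' ∉ n.primeFactors)
    (d : KolyvaginHeegnerData Dt β ι n) :
    ∃ (d' : KolyvaginHeegnerData Dt β ι (n * ℓ')) (d'' : KolyvaginHeegnerData Dt β ι (n / l₀ * ℓ')),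
      (∀ q ∈ n.primeFactors, ∀ (x : ringClassField K ι n) (x' : ringClassField K ι (n * ℓ')),
        (x : ℂ) = x' → ((d'.σ q x' : ringClassField K ι (n * ℓ')) : ℂ) = (d.σ q x : ℂ)) ∧
      (∀ s ∈ d.S, ∃ s' ∈ d'.S, ∀ (x : ringClassField K ι n) (x' : ringClassField K ι (n * ℓ')),
        (x : ℂ) = x' → ((s' x' : ringClassField K ι (n * ℓ')) : ℂ) = (s x : ℂ)) ∧
      (∀ s' ∈ d'.S, ∃ s ∈ d.S, ∀ (x : ringClassField K ι n) (x' : ringClassField K ι (n * ℓ')),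
        (x : ℂ) = x' → ((s' x' : ringClassField K ι (n * ℓ')) : ℂ) = (s x : ℂ)) ∧
      (∀ (x : ringClassField K ι n) (x' : ringClassField K ι (n * ℓ')),
        (x : ℂ) = x' → d'.emb x' = d.emb x) ∧
      (∀ q ∈ (n / l₀ * ℓ').primeFactors, ∀ (x : ringClassField K ι (n / l₀ * ℓ'))
        (x' : ringClassField K ι (n * ℓ')),
        (x : ℂ) = x' → ((d'.σ q x' : ringClassField K ι (n * ℓ')) : ℂ) = (d''.σ q x : ℂ)) ∧
      (∀ s ∈ d''.S, ∃ s' ∈ d'.S, ∀ (x : ringClassField K ι (n / l₀ * ℓ'))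
        (x' : ringClassField K ι (n * ℓ')),
        (x : ℂ) = x' → ((s' x' : ringClassField K ι (n * ℓ')) : ℂ) = (s x : ℂ)) ∧
      (∀ s' ∈ d'.S, ∃ s ∈ d''.S, ∀ (x : ringClassField K ι (n / l₀ * ℓ'))
        (x' : ringClassField K ι (n * ℓ')),
        (x : ℂ) = x' → ((s' x' : ringClassField K ι (n * ℓ')) : ℂ) = (s x : ℂ)) ∧
      (∀ (x : ringClassField K ι (n / l₀ * ℓ')) (x' : ringClassField K ι (n * ℓ')),
        (x : ℂ) = x' → d'.emb x' = d''.emb x) := by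
  have hn0 : n ≠ 0 := hn.ne_zero
  have hℓ'p : ℓ'.Prime := hKol'.1
  have hℓ'dvd : ¬ ℓ' ∣ n := fun h ↦ hℓ'n (Nat.mem_primeFactors.mpr ⟨hℓ'p, h, hn0⟩)
  have hN : Squarefree (n * ℓ') :=
    (Nat.squarefree_mul ((Nat.Prime.coprime_iff_not_dvd hℓ'p).mpr hℓ'dvd).symm).mpr ⟨hn, hℓ'p.squarefree⟩
  have hN0 : n * ℓ' ≠ 0 := hN.ne_zero
  have hNK : ∀ q ∈ (n * ℓ').primeFactors, Zhang2014.IsKolyvaginPrime N W K p q := by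
    intro q hq
    rw [Nat.primeFactors_mul hn0 hℓ'p.ne_zero, hℓ'p.primeFactors, Finset.mem_union,
      Finset.mem_singleton] at hq
    rcases hq with hq | rfl
    · exact hnK q hq
    · exact hKol'
  have hinert : ∀ q ∈ (n * ℓ').primeFactors, (Ideal.span {(q : 𝓞 K)}).IsPrime :=
    fun q hq ↦ (hNK q hq).2.2.2.2.1
  have hmn : n / l₀ * ℓ' ∣ n * ℓ' := Nat.mul_dvd_mul_right (Nat.div_dvd_of_dvd (Nat.dvd_of_mem_primeFactors hl₀)) ℓ'
  have hCM1 : phi_heegnerPointOfConductor_mem_range_map_ringClassField N W K :=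
    phi_heegnerPointOfConductor_mem_range_map_ringClassField_holds N W K
  have hCM2 : exists_generator_ringClassGalOver K := exists_generator_ringClassGalOver_holds
  obtain ⟨dN⟩ := nonempty_kolyvaginHeegnerData_of_grossCM hCM1 hCM2 hK hH Dt β ι d.dvd_sq_sub hN hinert
  obtain ⟨dm⟩ := nonempty_kolyvaginHeegnerData_of_grossCM hCM1 hCM2 hK hH Dt β ι d.dvd_sq_sub
    (hN.squarefree_of_dvd hmn) (fun q hq ↦ hinert q (Nat.primeFactors_mono hmn hN0 hq))
  exact exists_compatible_data_triple hK hD ι Dt hN hl₀ hinert d dN.y dN.map_y dm.y dm.map_y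

end Summit.BirchSwinnertonDyer.Rank1Residual.JET

end
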